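import Literature.NumberTheory.ComplexMultiplication.CMTypeUniformization
import Literature.NumberTheory.NumberFields.IdeleActionOnIdealQuotients
import Literature.AlgebraicGeometry.Motives.AbelianVarietyConjugate
import HarnessLib

/-!
# The twisting multiplier of Casselman's theorem stabilises the lattice: `c_σ 𝔞 = 𝔞`, and `c_σ` as an
# endomorphism of `K/𝔞` (Shimura 1998, §21.4 proof of Thm. 21.4 pp. 147–148 «`β(y) g(s)⁻¹ 𝔞 = 𝔞`»; §18.3 (18.3a) p. 122)

In Shimura's proof of Thm. 21.4 [Shimura1998, pp. 147–148; held chunk p0192] the isomorphism `λ_σ : A → A^σ` satisfies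
`r(w)^σ = λ_σ(r(c_σ w))` for every `w ∈ K/𝔞`, with the finite idèle `c_σ = β(y) f(y)⁻¹` of `K`; the printed
argument uses (19.10a, b) to see that `c_σ` stabilises the lattice, «`β(y) g(s)⁻¹ 𝔞 = 𝔞`», so that `c_σ w`
makes sense in `K/𝔞`.  The tree's λ-family statement (`stub_lambdaFamily` of the `h21` line, A-p03's
`exists_iso_conjugate_of_isArtinLift_of_thm18_6`) records only the torsion relation, phrased through
Shimura's (18.3a) «`t · (u mod 𝔞) = v (mod t𝔞)`» (`IdeleAction.ideleMulEquiv t 𝔞`).  This file shows that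
the lattice identity is a CONSEQUENCE of the mere existence of such a `λ` (no class field theory):

* `ideleMulIdeal_eq_self_of_twisted_relation` (abstract) — if `r : K → X` and `Q : K → Y` both detect
  congruence mod `𝔞` (`r u = r u′ → u − u′ ∈ 𝔞`), `λ : X → Y` is injective, and `Q u = λ (r v)` whenever
  `t · (u mod 𝔞) = v (mod t𝔞)`, then `t𝔞 = 𝔞`;
* `CMTypeUniformization.ideleMulIdeal_eq_self_of_iso_conjugate` — the case of the proof of Thm. 21.4:
  `r = ξ.r` (torsion parametrisation of `A`), `Q = (ξ.r ·)^σ` (`conjPoints`), `λ = λ_σ : A ≅ A^σ`;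
* `IdeleAction.ideleMulEquivSelf t 𝔞 h` — for an idèle with `t𝔞 = 𝔞`, **the (18.3a)-action as an
  `𝓞_K`-LINEAR AUTOMORPHISM OF `K/𝔞`** (`ideleMulEquiv t 𝔞` followed by the identification
  `K/t𝔞 = K/𝔞`), with `ideleMulEquivSelf_mk_eq_mk_iff` (same relation as `ideleMulEquiv`),
  `ideleMulEquivSelf_unitEmbedding` (`k ∈ K^×` acts as multiplication by `k`), `ideleMulEquivSelf_one`,
  `ideleMulEquivSelf_mul` (`(tt′)· = t· ∘ t′·`) and `ideleMulEquivSelf_smul` (`𝓞_K`-linearity) — the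
  endomorphism `c_σ` of `M = K/𝔞` in the shape consumed by the finite-level factorisation engine
  (`GroupTheory/FiniteLevelFactorisation`, `c : G →* AddMonoid.End M`).

Definitions with bodies and theorems; no named fact.  Cell `hodgecm-mathlib`, line `a2b`, support F2 for
`stub_finiteLevelReciprocity` / `stub_twistedModelOfFiniteLevel`.

## References

* [Shimura1998] G. Shimura, *Abelian Varieties with Complex Multiplication and Modular Functions* (1998),
  §21.4 proof of Thm. 21.4 pp. 147–148 (chunk p0192 L6 «β(y)g(s)⁻¹𝔞 = 𝔞», L9 «λ(r(w)) = r′(β(y)⁻¹w)», L13 «r(w)^σ = λ(r(cw))»),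
  §18.3 (18.3a) p. 122.
-/

noncomputable section

open scoped nonZeroDivisors NumberField
open CategoryTheory NumberField IsDedekindDomain

/-! ### (18.3a) with `t𝔞 = 𝔞`: the idèle action as an automorphism of `K/𝔞` -/

namespace Literature.NumberTheory.NumberFields.IdeleAction

variable {K : Type} [Field K] [NumberField K] (t t' : (FiniteAdeleRing (𝓞 K) K)ˣ)
  (𝔞 : FractionalIdeal (𝓞 K)⁰ K) (h𝔞 : 𝔞 ≠ 0)

/-- **`t·` as an `𝓞_K`-linear automorphism of `K/𝔞` when `t𝔞 = 𝔞`** ((18.3a) followed by the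
identification `K/t𝔞 = K/𝔞`; Shimura's `w ↦ c_σ w` on `K/𝔞` in the proof of Thm. 21.4).
[cite: Shimura1998, §18.3 (18.3a) p. 122; §21.4, proof of Thm. 21.4 (pp. 147–148)] -/
def ideleMulEquivSelf (h : ideleMulIdeal t 𝔞 = 𝔞) :
    (K ⧸ (𝔞 : Submodule (𝓞 K) K)) ≃ₗ[𝓞 K] (K ⧸ (𝔞 : Submodule (𝓞 K) K)) :=
  (ideleMulEquiv t 𝔞 h𝔞).trans (Submodule.quotEquivOfEq _ _ (by rw [h]))

/-- `ideleMulEquivSelf` satisfies the same relation as `ideleMulEquiv` (18.3a): for `u v : K`,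
`t · (u mod 𝔞) = v mod 𝔞` iff `t · (u mod 𝔞) = v mod t𝔞`. [cite: Shimura1998, §18.3 (18.3a) p. 122] -/
theorem ideleMulEquivSelf_mk_eq_mk_iff (h : ideleMulIdeal t 𝔞 = 𝔞) (u v : K) :
    ideleMulEquivSelf t 𝔞 h𝔞 h (Submodule.Quotient.mk u) = Submodule.Quotient.mk v ↔
      ideleMulEquiv t 𝔞 h𝔞 (Submodule.Quotient.mk u) = Submodule.Quotient.mk v := by
  unfold ideleMulEquivSelf
  rw [LinearEquiv.trans_apply]
  obtain ⟨w, hw⟩ := Submodule.Quotient.mk_surjective _ (ideleMulEquiv t 𝔞 h𝔞 (Submodule.Quotient.mk u))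
  rw [← hw, Submodule.quotEquivOfEq_mk, Submodule.Quotient.eq, Submodule.Quotient.eq, FractionalIdeal.mem_coe,
    FractionalIdeal.mem_coe, h]

/-- **A principal idèle `k ∈ K^×` with `k𝔞 = 𝔞` acts on `K/𝔞` as multiplication by `k`.**
[cite: Shimura1998, §18.3 (18.3a) p. 122] -/
theorem ideleMulEquivSelf_unitEmbedding_mk (k : Kˣ) (h : ideleMulIdeal (FiniteAdeleRing.unitEmbedding (𝓞 K) K k) 𝔞 = 𝔞)
    (u : K) :
    ideleMulEquivSelf (FiniteAdeleRing.unitEmbedding (𝓞 K) K k) 𝔞 h𝔞 h (Submodule.Quotient.mk u) =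
      Submodule.Quotient.mk ((k : K) * u) :=
  (ideleMulEquivSelf_mk_eq_mk_iff _ 𝔞 h𝔞 h u _).2 (ideleMulEquiv_unitEmbedding_mk k h𝔞 u)

/-- `1·` is the identity of `K/𝔞`. [cite: Shimura1998, §18.3 (18.3a) p. 122] -/
theorem ideleMulEquivSelf_one_apply (h : ideleMulIdeal (1 : (FiniteAdeleRing (𝓞 K) K)ˣ) 𝔞 = 𝔞)
    (q : K ⧸ (𝔞 : Submodule (𝓞 K) K)) : ideleMulEquivSelf 1 𝔞 h𝔞 h q = q := by
  obtain ⟨u, rfl⟩ := Submodule.Quotient.mk_surjective _ q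
  exact (ideleMulEquivSelf_mk_eq_mk_iff 1 𝔞 h𝔞 h u u).2 (ideleMulEquiv_one_mk h𝔞 u)

/-- **`(tt′)· = t· ∘ t′·` on `K/𝔞`** (both idèles stabilising `𝔞`). [cite: Shimura1998, §18.3 p. 122] -/
theorem ideleMulEquivSelf_mul_apply (h : ideleMulIdeal t 𝔞 = 𝔞) (h' : ideleMulIdeal t' 𝔞 = 𝔞)
    (hh : ideleMulIdeal (t * t') 𝔞 = 𝔞) (q : K ⧸ (𝔞 : Submodule (𝓞 K) K)) :
    ideleMulEquivSelf (t * t') 𝔞 h𝔞 hh q = ideleMulEquivSelf t 𝔞 h𝔞 h (ideleMulEquivSelf t' 𝔞 h𝔞 h' q) := by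
  obtain ⟨u, rfl⟩ := Submodule.Quotient.mk_surjective _ q
  obtain ⟨w, hw, -⟩ := exists_ideleMulEquiv_mk_eq_mk t' h𝔞 u
  -- `t' · (u mod 𝔞) = w mod 𝔞`
  have hw' : ideleMulEquivSelf t' 𝔞 h𝔞 h' (Submodule.Quotient.mk u) = Submodule.Quotient.mk w :=
    (ideleMulEquivSelf_mk_eq_mk_iff t' 𝔞 h𝔞 h' u w).2 hw
  obtain ⟨x, hx, -⟩ := exists_ideleMulEquiv_mk_eq_mk t h𝔞 w
  have hx' : ideleMulEquivSelf t 𝔞 h𝔞 h (Submodule.Quotient.mk w) = Submodule.Quotient.mk x :=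
    (ideleMulEquivSelf_mk_eq_mk_iff t 𝔞 h𝔞 h w x).2 hx
  rw [hw', hx']
  -- `t · (w mod t'𝔞) = x mod t(t'𝔞)`: transport `hx` along `t'𝔞 = 𝔞`
  have hx'' : ideleMulEquiv t (ideleMulIdeal t' 𝔞) (ideleMulIdeal_ne_zero t' h𝔞) (Submodule.Quotient.mk w) =
      Submodule.Quotient.mk x := by
    rw [ideleMulEquiv_mk_eq_mk_iff] at hx ⊢
    rwa [h']
  exact (ideleMulEquivSelf_mk_eq_mk_iff (t * t') 𝔞 h𝔞 hh u x).2 (ideleMulEquiv_mul_mk t t' h𝔞 hw hx'')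

/-- The product of two idèles stabilising `𝔞` stabilises `𝔞`. [cite: Shimura1998, §18.3 p. 122] -/
theorem ideleMulIdeal_mul_eq_self (h : ideleMulIdeal t 𝔞 = 𝔞) (h' : ideleMulIdeal t' 𝔞 = 𝔞) :
    ideleMulIdeal (t * t') 𝔞 = 𝔞 := by
  rw [ideleMulIdeal_mul, h', h]

/-- The inverse of an idèle stabilising `𝔞` stabilises `𝔞`. [cite: Shimura1998, §18.3 p. 122] -/
theorem ideleMulIdeal_inv_eq_self (h : ideleMulIdeal t 𝔞 = 𝔞) : ideleMulIdeal t⁻¹ 𝔞 = 𝔞 := by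
  conv_lhs => rw [← h]
  rw [← ideleMulIdeal_mul, inv_mul_cancel, ideleMulIdeal_one]

/-- `ideleMulEquivSelf t` as an additive endomorphism of `K/𝔞` (the shape `AddMonoid.End M` of the
finite-level factorisation engine). [cite: Shimura1998, §21.4, proof of Thm. 21.4 (pp. 147–148) («r(w)^σ = λ(r(cw))»)] -/
def ideleMulEnd (h : ideleMulIdeal t 𝔞 = 𝔞) : AddMonoid.End (K ⧸ (𝔞 : Submodule (𝓞 K) K)) :=
  (ideleMulEquivSelf t 𝔞 h𝔞 h).toLinearMap.toAddMonoidHom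

/-- Unfolding `ideleMulEnd`. [cite: Shimura1998, §18.3 (18.3a) p. 122] -/
@[simp] theorem ideleMulEnd_apply (h : ideleMulIdeal t 𝔞 = 𝔞) (q : K ⧸ (𝔞 : Submodule (𝓞 K) K)) :
    ideleMulEnd t 𝔞 h𝔞 h q = ideleMulEquivSelf t 𝔞 h𝔞 h q := rfl

/-- `ideleMulEnd` commutes with the `𝓞_K`-module structure of `K/𝔞` (it is `𝓞_K`-linear).
[cite: Shimura1998, §18.3 (18.3a) p. 122] -/
theorem ideleMulEnd_smul (h : ideleMulIdeal t 𝔞 = 𝔞) (a : 𝓞 K) (q : K ⧸ (𝔞 : Submodule (𝓞 K) K)) :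
    ideleMulEnd t 𝔞 h𝔞 h (a • q) = a • ideleMulEnd t 𝔞 h𝔞 h q :=
  (ideleMulEquivSelf t 𝔞 h𝔞 h).map_smul a q

end Literature.NumberTheory.NumberFields.IdeleAction

/-! ### The multiplier of Casselman's theorem stabilises `𝔞` -/

namespace Literature.NumberTheory.ComplexMultiplication

open Literature.NumberTheory.NumberFields.IdeleAction (ideleMulIdeal ideleMulEquiv)
open Literature.AlgebraicGeometry.Motives (CMType AbelianVariety AlgPoints)

variable {K : Type} [Field K] [NumberField K]

/-- **A twisted torsion relation forces `t𝔞 = 𝔞`** (abstract form of Shimura's «`β(y)g(s)⁻¹𝔞 = 𝔞`»):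
let `𝔞 ≠ 0` be a fractional ideal and `t` a finite idèle of `K`; let `r : K → X` and `Q : K → Y` detect
congruence modulo `𝔞` (`r u = r u′ → u − u′ ∈ 𝔞`, likewise for `Q`), with `r` actually `𝔞`-PERIODIC, and
let `λ : X → Y` be injective.  If `Q u = λ (r v)` whenever `t · (u mod 𝔞) = v (mod t𝔞)` ((18.3a)), then
`t𝔞 = 𝔞`.  (For `x ∈ t𝔞`: `(0, 0)` and `(0, x)` are both admissible pairs, so `λ(r x) = λ(r 0)`, `x ∈ 𝔞`;
for `x ∈ 𝔞`: with `t·(u mod 𝔞) = x`, `Q u = λ(r x) = λ(r 0) = Q 0`, so `u ∈ 𝔞` and `x ≡ t·0 = 0 (mod t𝔞)`.)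
[cite: Shimura1998, §21.4, proof of Thm. 21.4 (pp. 147–148) («β(y)g(s)⁻¹𝔞 = 𝔞»)] -/
theorem ideleMulIdeal_eq_self_of_twisted_relation {X Y : Type*} (𝔞 : FractionalIdeal (𝓞 K)⁰ K) (h𝔞 : 𝔞 ≠ 0)
    (t : (FiniteAdeleRing (𝓞 K) K)ˣ) (r : K → X) (Q : K → Y) (lam : X → Y)
    (hr : ∀ u u', r u = r u' ↔ u - u' ∈ 𝔞) (hQ : ∀ u u', Q u = Q u' → u - u' ∈ 𝔞)
    (hlam : Function.Injective lam)
    (hrel : ∀ u v : K, ideleMulEquiv t 𝔞 h𝔞 (Submodule.Quotient.mk u) = Submodule.Quotient.mk v →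
      Q u = lam (r v)) :
    ideleMulIdeal t 𝔞 = 𝔞 := by
  -- `(0, 0)` is admissible
  have h00 : ideleMulEquiv t 𝔞 h𝔞 (Submodule.Quotient.mk (0 : K)) = Submodule.Quotient.mk 0 := by
    rw [Submodule.Quotient.mk_zero, map_zero, Submodule.Quotient.mk_zero]
  refine le_antisymm ?_ ?_
  · -- `t𝔞 ⊆ 𝔞`
    intro x hx
    have h0x : ideleMulEquiv t 𝔞 h𝔞 (Submodule.Quotient.mk (0 : K)) = Submodule.Quotient.mk x := by
      rw [h00, eq_comm, Submodule.Quotient.eq, sub_zero]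
      exact hx
    have h1 : lam (r x) = lam (r 0) := by rw [← hrel 0 x h0x, ← hrel 0 0 h00]
    have h2 := (hr x 0).1 (hlam h1)
    rwa [sub_zero] at h2
  · -- `𝔞 ⊆ t𝔞`
    intro x hx
    obtain ⟨u, hu⟩ := Submodule.Quotient.mk_surjective _
      ((ideleMulEquiv t 𝔞 h𝔞).symm (Submodule.Quotient.mk x))
    have hux : ideleMulEquiv t 𝔞 h𝔞 (Submodule.Quotient.mk u) = Submodule.Quotient.mk x := by
      rw [hu, LinearEquiv.apply_symm_apply]
    have hrx : r x = r 0 := (hr x 0).2 (by rw [sub_zero]; exact hx)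
    have hQ0 : Q u = Q 0 := by rw [hrel u x hux, hrx, ← hrel 0 0 h00]
    have hu0 : Submodule.Quotient.mk (p := (𝔞 : Submodule (𝓞 K) K)) u = Submodule.Quotient.mk 0 := by
      rw [Submodule.Quotient.eq]
      exact hQ u 0 hQ0
    have : Submodule.Quotient.mk (p := ((ideleMulIdeal t 𝔞 : FractionalIdeal (𝓞 K)⁰ K) : Submodule (𝓞 K) K)) x =
        Submodule.Quotient.mk 0 := by
      rw [← hux, hu0, h00]
    rw [Submodule.Quotient.eq, sub_zero] at this
    exact this

namespace CMTypeUniformization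

variable {Φ : CMType K} {𝔞 : (FractionalIdeal (𝓞 K)⁰ K)ˣ} {A : AbelianVariety ℂ} {ι : 𝓞 K →+* End A}
  (ξ : CMTypeUniformization Φ 𝔞 A ι)

/-- For an isomorphism `e : A ≅ B` of abelian varieties, `P ↦ e(P)` is injective on points. [folklore] -/
private theorem map_injective_of_iso {B : AbelianVariety ℂ} (e : A ≅ B) :
    Function.Injective (AlgPoints.map (L := ℂ) e.hom.hom.hom.hom) := by
  intro P P' h
  have h' := congrArg (AlgPoints.map (L := ℂ) e.inv.hom.hom.hom) h
  simp only [AlgPoints.map_apply, Category.assoc] at h'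
  have he : e.hom.hom.hom.hom ≫ e.inv.hom.hom.hom = 𝟙 _ := by
    change (e.hom ≫ e.inv).hom.hom.hom = _
    rw [Iso.hom_inv_id]
    rfl
  rwa [he, Category.comp_id, Category.comp_id] at h'

/-- **«`β(y) g(s)⁻¹ 𝔞 = 𝔞`» from the existence of `λ_σ`** (Shimura pp. 147–148): if an isomorphism
`λ : A ≅ A^σ` of the uniformised `(A, ι, ξ)` onto its conjugate satisfies the torsion relation
`r(u)^σ = λ(r(v))` whenever `t · (u mod 𝔞) = v (mod t𝔞)`, then the multiplier `t` stabilises the lattice: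
`t𝔞 = 𝔞`.  (In print this is deduced from (19.10a, b); here it is read off the relation itself.)
[cite: Shimura1998, §21.4, proof of Thm. 21.4 (pp. 147–148) («β(y)g(s)⁻¹𝔞 = 𝔞», «λ(r(w)) = r′(β(y)⁻¹w)», «r(w)^σ = λ(r(cw))»)] -/
theorem ideleMulIdeal_eq_self_of_iso_conjugate (σ : ℂ ≃+* ℂ) (t : (FiniteAdeleRing (𝓞 K) K)ˣ)
    (lam : A ≅ A.conjugate σ)
    (h : ∀ u v : K, ideleMulEquiv t (𝔞 : FractionalIdeal (𝓞 K)⁰ K) 𝔞.ne_zero (Submodule.Quotient.mk u) =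
        Submodule.Quotient.mk v → A.conjPoints σ (ξ.r u) = AlgPoints.map lam.hom.hom.hom.hom (ξ.r v)) :
    ideleMulIdeal t (𝔞 : FractionalIdeal (𝓞 K)⁰ K) = 𝔞 :=
  ideleMulIdeal_eq_self_of_twisted_relation (𝔞 : FractionalIdeal (𝓞 K)⁰ K) 𝔞.ne_zero t ξ.r
    (fun u ↦ A.conjPoints σ (ξ.r u)) (AlgPoints.map (L := ℂ) lam.hom.hom.hom.hom) ξ.r_eq_r_iff
    (fun u u' huu' ↦ (ξ.r_eq_r_iff u u').1 ((A.conjPoints σ).injective huu')) (map_injective_of_iso lam) h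

end CMTypeUniformization

end Literature.NumberTheory.ComplexMultiplication

end
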